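import Summits.QuantumFields.YangMills.Theorems.AllWindowsColdBoxBoxHighLineTiltUMomentsPrelims

/-!
# U5-L3-concrete STAGE 2 — ALL EVEN restricted-Gaussian moments of the tilt exponent: `E₀[1_D·(tiltU − b)^{2k}] ≲ (H⁴/β)^k·polylog + tails`
# (the `U`-slots `RU₂/RU₄/RU₆` of ✓`GaussNormalForm.abs_tiltCum5_muD_le_of_sizes` with ONE common `b`; `Cruxes/BoxWindowHighSU2213/U5-BLOCKERS.md` §2 L3;
#  LINE-20 U5 ⟨stmt-QuantumFields-24336⟩)

Width seat `ym-line-sfw-p2-w5` (prover-ym-line-sfw-p2-w5-g24-0), continuing fcl-p3 g26's ✓`…TiltCum5Sizes` («STAGE 2: discharge RU₄, RU₆») over this seat's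
✓`…TiltUMomentsPrelims`.  With `D = smallField H s`, `U = tiltU β H`, `b = E₀[quadVal M_H] + E₀[quadVal(−I/3)]` (the centring of ✓13K-U) and the
eight-term decomposition

  `U − b = −(V₃ − F) − F − W₄ − U_Φ + (g − q_M) + (q_M − c_M) + (h − q_h) + (q_h − c_h)`

(`F` = cubic Taylor POLYNOMIAL of `V₃`, ✓`exists_cubicVertexPoly`; `W₄ = quarticWilson`, `U_Φ = β(Φ − divLinSq)`, `g = ghostLogRatio`, `h = haarLogRatio`,
`q_M = quadVal M_H`, `q_h = quadVal(−I/3)`), the power mean `(Σ₈)^{2k} ≤ 8^{2k−1}Σ(·)^{2k}`, Gaussian hypercontractivity for the five POLYNOMIAL pieces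
(`F` deg 3; `|W₄| ≤ β√K·G_W`, `|U_Φ| ≤ βC_Φ·G_Φ` with `G_W`, `G_Φ` deg 4; `q_M − c_M`, `q_h − c_h` deg 2) and sup bounds ONLY for the three genuine Taylor
tails (`|V₃ − F| ≤ C_VβH⁴s⁵`, `|g − q_M| ≤ C_gH⁶(1+log H)^m s³` ✓`ghostTaylor`, `|h − q_h| ≤ C_h·n·s⁴` ✓7c) give

* ★★★ `gaussAvg_sfInd_mul_tiltU_sub_pow_even_le` — `∃ C m c₀, ∀ H ≥ 1, β ≥ H⁴, 0 ≤ s ≤ 1, s·H² ≤ c₀, ∃ b, ∀ k ≥ 1,`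
  `E₀[1_D·(U − b)^{2k}] ≤ C k·(1+log H)^{m k}·((H⁴/β)^k + (βH⁴s⁵)^{2k} + (H⁶s³)^{2k} + (H⁴s⁴)^{2k})`;
* the `k = 1, 2, 3` instances in the `^2/^4/^6` shape of the slots and the discharged `κ₅` bound are in the sequel `…TiltCum5SizesU`.

In U5 letters (`s = β^{κ₃−1/2}`, `H = β^θ`) every bracket is `≍ (H⁴/β)^k` (so every κ₅ term is `≍ H⁶β^{−7/2}·polylog`); NO sup bound is used for `W₄`.
Tree only; no definitions; standard axioms.  HONEST LABEL: U5 prep, helper-grade bookkeeping for the recorded lift L3 of the NEXT rung U5 (⟨24336⟩ UNSTAFFED);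
⟨24004⟩ ⟨24336⟩ OPEN; route AllWindowsColdBox DRAFT; no crux, rung or summit is proved; **the Yang–Mills mass gap is NOT proved by this file; no summit is
proved by a line.**
-/

set_option autoImplicit false

noncomputable section

open MeasureTheory Matrix Finset
open scoped Kronecker
open Literature.Probability.LatticeModels (Site)
open Literature.MathematicalPhysics.QuantumLattice (plaquettesTouching)
open Literature.MathematicalPhysics.QuantumFieldTheory.AxialGauge (boxEdges)

namespace Summit.QuantumFields.YangMills.Theorems.AllWindowsColdBoxBoxHighLine

namespace GaussNormalForm

open EdgeChartGaussian (integrable_gaussWeight gaussAvg_mono_of_nonneg gaussAvg_nonneg gaussAvg_const_fun polyCert_const polyCert_coord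
  polyCert_add polyCert_sub polyCert_const_mul polyCert_mul polyCert_pow polyCert_sum polyCert_mono integrable_polyCert_mul_gaussWeight
  gaussAvg_pow_even_le_of_polyCert)
open LaplaceSandwich (flatten flatten_apply)

variable {H : ℕ} {β : ℝ}

/-! ## §6 The higher restricted-Gaussian moments of the tilt exponent -/

/-- ★★★ **U5-L3-concrete STAGE 2 — ALL EVEN restricted-Gaussian moments of the tilt exponent, ONE centring constant.**
There are `C : ℕ → ℝ≥0`, `m : ℕ → ℕ` and `c₀ > 0` (✓7d's) such that for all `H ≥ 1`, `β ≥ H⁴`, `0 ≤ s ≤ 1`, `s·H² ≤ c₀` there is ONE constant `b`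
(`= E₀[quadVal M_H] + E₀[quadVal(−I/3)]`, as in ✓13K-U) with, for EVERY `k ≥ 1`,

  `E₀[1_{smallField H s} · (tiltU β H − b)^{2k}] ≤ C k · (1 + log H)^{m k} · ((H⁴/β)^k + (β·H⁴·s⁵)^{2k} + (H⁶·s³)^{2k} + (H⁴·s⁴)^{2k})`.

(`k = 1, 2, 3` are the slots `RU₂, RU₄, RU₆` of ✓`abs_tiltCum5_muD_le_of_sizes`; in U5 letters `s = β^{κ₃−1/2}`, `H = β^θ` every term is `(H⁴/β)^k·polylog`-sized or smaller.)
Eight-term decomposition `U − b = −(V₃−F) − F − W₄ − U_Φ + (g−q_M) + (q_M−c_M) + (h−q_h) + (q_h−c_h)`, power mean, hypercontractivity for the five polynomial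
pieces (`F` deg 3, `G_W`, `G_Φ` deg 4, `q_M − c_M`, `q_h − c_h` deg 2), sup bounds for the three genuine Taylor tails (quintic Wilson ✓`exists_cubicVertexPoly` (ii),
cubic ghost ✓`ghostTaylor`, quartic Haar ✓`abs_haarLogRatio_sub_quadVal_le`). -/
theorem gaussAvg_sfInd_mul_tiltU_sub_pow_even_le :
    ∃ C : ℕ → ℝ, ∃ m : ℕ → ℕ, ∃ c₀ : ℝ, 0 < c₀ ∧ (∀ k, 0 ≤ C k) ∧
      ∀ H : ℕ, 1 ≤ H → ∀ β : ℝ, (H : ℝ) ^ 4 ≤ β → ∀ s : ℝ, 0 ≤ s → s ≤ 1 → s * (H : ℝ) ^ 2 ≤ c₀ →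
        ∃ b : ℝ, ∀ k : ℕ, 1 ≤ k →
          gaussAvg β H (fun a => sfInd H s a * (tiltU β H a - b) ^ (2 * k)) ≤
            C k * (1 + Real.log H) ^ (m k) *
              (((H : ℝ) ^ 4 / β) ^ k + (β * (H : ℝ) ^ 4 * s ^ 5) ^ (2 * k) + ((H : ℝ) ^ 6 * s ^ 3) ^ (2 * k) + ((H : ℝ) ^ 4 * s ^ 4) ^ (2 * k)) := by
  obtain ⟨Cg, c₀, mg, hc₀, hg⟩ := ghostTaylor
  obtain ⟨CV, hCV0, hV⟩ := EdgeChartGaussian.exists_cubicVertexPoly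
  obtain ⟨KW, hKW0, hW⟩ := abs_quarticWilson_le_wilsonG
  obtain ⟨KΦ, hKΦ0, hΦ⟩ := abs_phi_sub_divLinSq_le_phiG
  obtain ⟨Cb, hCb0, hCb⟩ := gaussAvg_quadVal_centred_sq_le
  obtain ⟨Ch, hCh0, hCh⟩ := abs_haarLogRatio_sub_quadVal_le
  -- `Cg ≥ 0` (read off at `H = 1`)
  have hCg0 : 0 ≤ Cg := by
    obtain ⟨M, hM, -⟩ := hg 1 le_rfl
    have hS : 0 ≤ ∑ i, ∑ j, M i j ^ 2 := Finset.sum_nonneg fun i _ => Finset.sum_nonneg fun j _ => sq_nonneg _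
    have e : Cg * ((1 : ℕ) : ℝ) ^ 4 * (1 + Real.log ((1 : ℕ) : ℝ)) ^ mg = Cg := by
      rw [Nat.cast_one, Real.log_one, add_zero, one_pow, one_pow, mul_one, mul_one]
    rw [e] at hM
    linarith
  set C₈ : ℝ := 81 * (60 * 1036 ^ 2) ^ 2 with hC₈
  -- the eight coefficient constants, as functions of `k`
  set Cst : ℕ → ℝ := fun k =>
    8 ^ (2 * k - 1) * (CV ^ (2 * k) + (2 * k - 1 : ℝ) ^ (k * 3) * CV ^ k + (2 * k - 1 : ℝ) ^ (k * 4) * (KW ^ 2 * (9720 ^ 2 * C₈)) ^ k +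
      (2 * k - 1 : ℝ) ^ (k * 4) * (KΦ ^ 2 * (2 ^ 20 * C₈)) ^ k + Cg ^ (2 * k) + (2 * k - 1 : ℝ) ^ (k * 2) * (Cb * Cg) ^ k +
      (Ch * 216) ^ (2 * k) + (2 * k - 1 : ℝ) ^ (k * 2) * (Cb * 72) ^ k) with hCst
  have hCst0 : ∀ k, 0 ≤ Cst k := by
    intro k
    simp only [hCst]
    rcases Nat.eq_zero_or_pos k with rfl | hk
    · norm_num
    · have hk1 : (0 : ℝ) ≤ 2 * k - 1 := by
        have : (1 : ℝ) ≤ k := by exact_mod_cast hk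
        linarith
      positivity
  refine ⟨Cst, fun k => 3 * k + 2 * (k * mg), c₀, hc₀, hCst0, fun H hH β hβ s hs0 hs1 hsH => ?_⟩
  have hH1 : (1 : ℝ) ≤ H := by exact_mod_cast hH
  have hH0 : (0 : ℝ) ≤ H := by positivity
  have hβ1 : 1 ≤ β := le_trans (one_le_pow₀ hH1) hβ
  have hβpos : 0 < β := lt_of_lt_of_le one_pos hβ1
  have hlog : 0 ≤ Real.log H := Real.log_nonneg hH1
  obtain ⟨L, hL⟩ : ∃ L : ℝ, L = 1 + Real.log H := ⟨_, rfl⟩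
  have hL1 : 1 ≤ L := by rw [hL]; linarith only [hlog]
  obtain ⟨A, hA⟩ : ∃ A : ℝ, A = (H : ℝ) ^ 4 / β := ⟨_, rfl⟩
  have hA0 : 0 ≤ A := by rw [hA]; positivity
  have hA1 : A ≤ 1 := by rw [hA]; exact (div_le_one hβpos).2 hβ
  -- the ghost quadratic form and the cubic Taylor polynomial of `V₃`
  obtain ⟨M, hM, hT⟩ := hg H hH
  obtain ⟨F, hFc, hFs, hFg⟩ := hV H hH β hβpos
  set Mh : Matrix (LandauFree H × Fin 3) (LandauFree H × Fin 3) ℝ := (-(1 / 3 : ℝ)) • (1 : Matrix (LandauFree H × Fin 3) (LandauFree H × Fin 3) ℝ)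
    with hMh
  obtain ⟨cM, hcM⟩ : ∃ c : ℝ, c = gaussAvg β H (quadVal M) := ⟨_, rfl⟩
  obtain ⟨ch, hch⟩ : ∃ c : ℝ, c = gaussAvg β H (quadVal Mh) := ⟨_, rfl⟩
  obtain ⟨n, hn⟩ : ∃ n : ℝ, n = (Fintype.card (LandauFree H) : ℝ) := ⟨_, rfl⟩
  have hnle : n ≤ 216 * (H : ℝ) ^ 4 := by rw [hn]; exact SmallFieldFP.card_landauFree_le hH
  have hn0 : 0 ≤ n := by rw [hn]; exact Nat.cast_nonneg _
  -- the three sup constants (opaque)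
  obtain ⟨y₁, hy₁⟩ : ∃ y : ℝ, y = CV * β * (H : ℝ) ^ 4 * s ^ 5 := ⟨_, rfl⟩
  obtain ⟨y₅, hy₅⟩ : ∃ y : ℝ, y = Cg * (H : ℝ) ^ 6 * (1 + Real.log H) ^ mg * s ^ 3 := ⟨_, rfl⟩
  obtain ⟨y₇, hy₇⟩ : ∃ y : ℝ, y = Ch * n * s ^ 4 := ⟨_, rfl⟩
  have hy₁0 : 0 ≤ y₁ := by rw [hy₁]; positivity
  have hy₅0 : 0 ≤ y₅ := by rw [hy₅]; positivity
  have hy₇0 : 0 ≤ y₇ := by rw [hy₇]; positivity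
  refine ⟨cM + ch, fun k hk => ?_⟩
  -- abbreviations for the two quartic dominators
  obtain ⟨GW, hGWdef⟩ : ∃ G : (LandauFree H → E3) → ℝ, G = fun a =>
      ∑ p ∈ plaquettesTouching (boxEdges 4 (2 * H + 1)), (∑ i : Fin 4, ‖plaqVar H p.1 p.2.1.1 p.2.1.2 a i‖ ^ 2) ^ 2 := ⟨_, rfl⟩
  obtain ⟨GΦ, hGΦdef⟩ : ∃ G : (LandauFree H → E3) → ℝ, G = fun a =>
      ∑ x ∈ interiorSites H, (∑ e : LandauFree H, |gradVec H x e| * ‖a e‖ ^ 2) ^ 2 := ⟨_, rfl⟩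
  have hGWa : ∀ a, GW a = ∑ p ∈ plaquettesTouching (boxEdges 4 (2 * H + 1)), (∑ i : Fin 4, ‖plaqVar H p.1 p.2.1.1 p.2.1.2 a i‖ ^ 2) ^ 2 :=
    fun a => by rw [hGWdef]
  have hGΦa : ∀ a, GΦ a = ∑ x ∈ interiorSites H, (∑ e : LandauFree H, |gradVec H x e| * ‖a e‖ ^ 2) ^ 2 := fun a => by rw [hGΦdef]
  have hGW0 : ∀ a, 0 ≤ GW a := fun a => by rw [hGWa]; exact Finset.sum_nonneg fun p _ => sq_nonneg _
  have hGΦ0 : ∀ a, 0 ≤ GΦ a := fun a => by rw [hGΦa]; exact Finset.sum_nonneg fun x _ => sq_nonneg _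
  have hk2 : 2 * k - 1 + 1 = 2 * k := by omega
  have hk1r : (0 : ℝ) ≤ 2 * k - 1 := by
    have : (1 : ℝ) ≤ k := by exact_mod_cast hk
    linarith only [this]
  have heven : Even (2 * k) := even_two_mul k
  -- the polynomial part and the constant part of the majorant
  obtain ⟨P, hP⟩ : ∃ P : (LandauFree H → E3) → ℝ, P = fun a =>
    F a ^ (2 * k) + (β * KW) ^ (2 * k) * GW a ^ (2 * k) + (β * KΦ) ^ (2 * k) * GΦ a ^ (2 * k) + (quadVal M a - cM) ^ (2 * k) +
      (quadVal Mh a - ch) ^ (2 * k) := ⟨_, rfl⟩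
  have hPa : ∀ a, P a = F a ^ (2 * k) + (β * KW) ^ (2 * k) * GW a ^ (2 * k) + (β * KΦ) ^ (2 * k) * GΦ a ^ (2 * k) + (quadVal M a - cM) ^ (2 * k) +
      (quadVal Mh a - ch) ^ (2 * k) := fun a => by rw [hP]
  obtain ⟨Kc, hKc⟩ : ∃ K : ℝ, K = y₁ ^ (2 * k) + y₅ ^ (2 * k) + y₇ ^ (2 * k) := ⟨_, rfl⟩
  have hKc0 : 0 ≤ Kc := by rw [hKc]; positivity
  have hP0 : ∀ a, 0 ≤ P a := fun a => by
    rw [hPa]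
    have h1 : 0 ≤ F a ^ (2 * k) := heven.pow_nonneg _
    have h2 : 0 ≤ (β * KW) ^ (2 * k) * GW a ^ (2 * k) := mul_nonneg (heven.pow_nonneg _) (pow_nonneg (hGW0 a) _)
    have h3 : 0 ≤ (β * KΦ) ^ (2 * k) * GΦ a ^ (2 * k) := mul_nonneg (heven.pow_nonneg _) (pow_nonneg (hGΦ0 a) _)
    have h4 : 0 ≤ (quadVal M a - cM) ^ (2 * k) := heven.pow_nonneg _
    have h5 : 0 ≤ (quadVal Mh a - ch) ^ (2 * k) := heven.pow_nonneg _
    exact add_nonneg (add_nonneg (add_nonneg (add_nonneg h1 h2) h3) h4) h5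
  -- (1) pointwise domination `1_D·(U − b)^{2k} ≤ 8^{2k−1}·(P + Kc)`
  have hdom : ∀ a, sfInd H s a * (tiltU β H a - (cM + ch)) ^ (2 * k) ≤ 8 ^ (2 * k - 1) * (P a + Kc) := by
    intro a
    by_cases ha : a ∈ smallField H s
    · rw [sfInd, Set.indicator_of_mem ha, one_mul]
      -- the eight absolute values
      have e := tiltU_sub_eq_eight β H a (F a) (quadVal M a) (quadVal Mh a) cM ch
      have h1 : |-(cubicVertex β H a - F a)| ≤ y₁ := by rw [abs_neg, hy₁]; exact hFs s hs0 a ha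
      have h2 : |-F a| = |F a| := abs_neg _
      have h3 : |-quarticWilson β H a| ≤ β * KW * GW a := by
        calc |-quarticWilson β H a| = |quarticWilson β H a| := abs_neg _
          _ ≤ |β| * KW * ∑ p ∈ plaquettesTouching (boxEdges 4 (2 * H + 1)), (∑ i : Fin 4, ‖plaqVar H p.1 p.2.1.1 p.2.1.2 a i‖ ^ 2) ^ 2 := hW β H a
          _ = β * KW * GW a := by rw [abs_of_pos hβpos, hGWa]
      have h4 : |-(β * (landauPhi H (edgeChart H a) - divLinSq H a))| ≤ β * KΦ * GΦ a := by
        calc |-(β * (landauPhi H (edgeChart H a) - divLinSq H a))| = β * |landauPhi H (edgeChart H a) - divLinSq H a| := by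
              rw [abs_neg, abs_mul, abs_of_pos hβpos]
          _ ≤ β * (KΦ * ∑ x ∈ interiorSites H, (∑ e : LandauFree H, |gradVec H x e| * ‖a e‖ ^ 2) ^ 2) :=
              mul_le_mul_of_nonneg_left (hΦ H hH a) hβpos.le
          _ = β * KΦ * GΦ a := by rw [hGΦa]; ring
      have h5 : |ghostLogRatio H a - quadVal M a| ≤ y₅ := by rw [hy₅]; exact hT s a hs0 hsH ha
      have h7 : |haarLogRatio H a - quadVal Mh a| ≤ y₇ := by rw [hy₇, hn]; exact hCh H s hs0 hs1 a ha
      have habs : |tiltU β H a - (cM + ch)| ≤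
          y₁ + |F a| + β * KW * GW a + β * KΦ * GΦ a + y₅ + |quadVal M a - cM| + y₇ + |quadVal Mh a - ch| := by
        rw [e]
        refine (abs_add_eight_le _ _ _ _ _ _ _ _).trans ?_
        rw [h2]
        linarith only [h1, h3, h4, h5, h7]
      have hW3 : 0 ≤ β * KW * GW a := mul_nonneg (mul_nonneg hβpos.le hKW0) (hGW0 a)
      have hΦ4 : 0 ≤ β * KΦ * GΦ a := mul_nonneg (mul_nonneg hβpos.le hKΦ0) (hGΦ0 a)
      have hpm := abs_pow_le_of_abs_le_sum_eight hy₁0 (abs_nonneg (F a)) hW3 hΦ4 hy₅0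
        (abs_nonneg (quadVal M a - cM)) hy₇0 (abs_nonneg (quadVal Mh a - ch)) habs (2 * k - 1)
      rw [hk2, heven.pow_abs, heven.pow_abs, heven.pow_abs, heven.pow_abs, mul_pow, mul_pow] at hpm
      refine hpm.trans (le_of_eq ?_)
      rw [hPa, hKc]
      ring
    · rw [sfInd, Set.indicator_of_notMem ha, zero_mul]
      exact mul_nonneg (pow_nonneg (by norm_num) _) (add_nonneg (hP0 a) hKc0)
  -- (2) polynomial certificates and integrability of the five polynomial pieces
  have hpF : ∃ Q : MvPolynomial (LandauFree H × Fin 3) ℝ, Q.totalDegree ≤ 2 * k * 4 ∧ ∀ a, F a ^ (2 * k) = MvPolynomial.eval (flatten (LandauFree H) a) Q :=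
    polyCert_mono (by omega) (polyCert_pow hFc (2 * k))
  have hpW : ∃ Q : MvPolynomial (LandauFree H × Fin 3) ℝ, Q.totalDegree ≤ 2 * k * 4 ∧
      ∀ a, (β * KW) ^ (2 * k) * GW a ^ (2 * k) = MvPolynomial.eval (flatten (LandauFree H) a) Q := by
    rw [hGWdef]; exact polyCert_const_mul _ (polyCert_pow (polyCert_wilsonG H) (2 * k))
  have hpΦ : ∃ Q : MvPolynomial (LandauFree H × Fin 3) ℝ, Q.totalDegree ≤ 2 * k * 4 ∧
      ∀ a, (β * KΦ) ^ (2 * k) * GΦ a ^ (2 * k) = MvPolynomial.eval (flatten (LandauFree H) a) Q := by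
    rw [hGΦdef]; exact polyCert_const_mul _ (polyCert_pow (polyCert_phiG H) (2 * k))
  have hcGW : ∃ Q : MvPolynomial (LandauFree H × Fin 3) ℝ, Q.totalDegree ≤ 4 ∧ ∀ a, GW a = MvPolynomial.eval (flatten (LandauFree H) a) Q := by
    rw [hGWdef]; exact polyCert_wilsonG H
  have hcGΦ : ∃ Q : MvPolynomial (LandauFree H × Fin 3) ℝ, Q.totalDegree ≤ 4 ∧ ∀ a, GΦ a = MvPolynomial.eval (flatten (LandauFree H) a) Q := by
    rw [hGΦdef]; exact polyCert_phiG H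
  have hBW : gaussAvg β H (fun a => GW a ^ 2) ≤ 9720 ^ 2 * C₈ * (H : ℝ) ^ 8 / β ^ 4 := by
    rw [hGWdef]; exact gaussAvg_wilsonG_sq_le hH hβpos
  have hBΦ : gaussAvg β H (fun a => GΦ a ^ 2) ≤ 2 ^ 20 * C₈ * (H : ℝ) ^ 8 / β ^ 4 := by
    rw [hGΦdef]; exact gaussAvg_phiG_sq_le hβpos
  have hpM : ∃ Q : MvPolynomial (LandauFree H × Fin 3) ℝ, Q.totalDegree ≤ 2 * k * 4 ∧
      ∀ a, (quadVal M a - cM) ^ (2 * k) = MvPolynomial.eval (flatten (LandauFree H) a) Q :=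
    polyCert_mono (by omega) (polyCert_pow (polyCert_quadVal_sub M cM) (2 * k))
  have hph : ∃ Q : MvPolynomial (LandauFree H × Fin 3) ℝ, Q.totalDegree ≤ 2 * k * 4 ∧
      ∀ a, (quadVal Mh a - ch) ^ (2 * k) = MvPolynomial.eval (flatten (LandauFree H) a) Q :=
    polyCert_mono (by omega) (polyCert_pow (polyCert_quadVal_sub Mh ch) (2 * k))
  have hiF := integrable_polyCert_mul_gaussWeight H hβpos hpF
  have hiW := integrable_polyCert_mul_gaussWeight H hβpos hpW
  have hiΦ := integrable_polyCert_mul_gaussWeight H hβpos hpΦ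
  have hiM := integrable_polyCert_mul_gaussWeight H hβpos hpM
  have hih := integrable_polyCert_mul_gaussWeight H hβpos hph
  have hi2 : Integrable (fun a => (F a ^ (2 * k) + (β * KW) ^ (2 * k) * GW a ^ (2 * k)) * gaussWeight β H a) :=
    (hiF.add hiW).congr (Filter.Eventually.of_forall fun a => by simp only [Pi.add_apply]; ring)
  have hi3 : Integrable (fun a => (F a ^ (2 * k) + (β * KW) ^ (2 * k) * GW a ^ (2 * k) + (β * KΦ) ^ (2 * k) * GΦ a ^ (2 * k)) * gaussWeight β H a) :=
    (hi2.add hiΦ).congr (Filter.Eventually.of_forall fun a => by simp only [Pi.add_apply]; ring)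
  have hi4 : Integrable (fun a => (F a ^ (2 * k) + (β * KW) ^ (2 * k) * GW a ^ (2 * k) + (β * KΦ) ^ (2 * k) * GΦ a ^ (2 * k) +
      (quadVal M a - cM) ^ (2 * k)) * gaussWeight β H a) :=
    (hi3.add hiM).congr (Filter.Eventually.of_forall fun a => by simp only [Pi.add_apply]; ring)
  have hiP : Integrable (fun a => P a * gaussWeight β H a) :=
    (hi4.add hih).congr (Filter.Eventually.of_forall fun a => by simp only [Pi.add_apply, hPa]; ring)
  have hiKc : Integrable (fun a : LandauFree H → E3 => Kc * gaussWeight β H a) := (integrable_gaussWeight H hβpos).const_mul _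
  have hiMaj : Integrable (fun a => (8 ^ (2 * k - 1) * (P a + Kc)) * gaussWeight β H a) :=
    ((hiP.add hiKc).const_mul (8 ^ (2 * k - 1))).congr (Filter.Eventually.of_forall fun a => by simp only [Pi.add_apply]; ring)
  -- (3) linearity
  have hEP : gaussAvg β H P = gaussAvg β H (fun a => F a ^ (2 * k)) + gaussAvg β H (fun a => (β * KW) ^ (2 * k) * GW a ^ (2 * k)) +
      gaussAvg β H (fun a => (β * KΦ) ^ (2 * k) * GΦ a ^ (2 * k)) + gaussAvg β H (fun a => (quadVal M a - cM) ^ (2 * k)) +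
      gaussAvg β H (fun a => (quadVal Mh a - ch) ^ (2 * k)) := by
    have e : P = fun a => (F a ^ (2 * k) + (β * KW) ^ (2 * k) * GW a ^ (2 * k) + (β * KΦ) ^ (2 * k) * GΦ a ^ (2 * k) +
        (quadVal M a - cM) ^ (2 * k)) + (quadVal Mh a - ch) ^ (2 * k) := hP
    rw [e, EdgeChartGaussian.gaussAvg_add β H hi4 hih]
    rw [show (fun a => F a ^ (2 * k) + (β * KW) ^ (2 * k) * GW a ^ (2 * k) + (β * KΦ) ^ (2 * k) * GΦ a ^ (2 * k) + (quadVal M a - cM) ^ (2 * k)) =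
      fun a => (F a ^ (2 * k) + (β * KW) ^ (2 * k) * GW a ^ (2 * k) + (β * KΦ) ^ (2 * k) * GΦ a ^ (2 * k)) + (quadVal M a - cM) ^ (2 * k) from rfl,
      EdgeChartGaussian.gaussAvg_add β H hi3 hiM]
    rw [show (fun a => F a ^ (2 * k) + (β * KW) ^ (2 * k) * GW a ^ (2 * k) + (β * KΦ) ^ (2 * k) * GΦ a ^ (2 * k)) =
      fun a => (F a ^ (2 * k) + (β * KW) ^ (2 * k) * GW a ^ (2 * k)) + (β * KΦ) ^ (2 * k) * GΦ a ^ (2 * k) from rfl,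
      EdgeChartGaussian.gaussAvg_add β H hi2 hiΦ]
    rw [show (fun a => F a ^ (2 * k) + (β * KW) ^ (2 * k) * GW a ^ (2 * k)) = fun a => F a ^ (2 * k) + (β * KW) ^ (2 * k) * GW a ^ (2 * k) from rfl,
      EdgeChartGaussian.gaussAvg_add β H hiF hiW]
  have hEMaj : gaussAvg β H (fun a => 8 ^ (2 * k - 1) * (P a + Kc)) = 8 ^ (2 * k - 1) * (gaussAvg β H P + Kc) := by
    rw [EdgeChartGaussian.gaussAvg_const_mul]
    congr 1
    rw [show (fun a => P a + Kc) = fun a => P a + Kc from rfl, EdgeChartGaussian.gaussAvg_add β H hiP hiKc, gaussAvg_const_fun H hβpos]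
  -- (4) the five hypercontractive moment bounds
  have hE1 : gaussAvg β H (fun a => F a ^ (2 * k)) ≤ (2 * k - 1 : ℝ) ^ (k * 3) * (CV * (H : ℝ) ^ 4 * (1 + Real.log H) ^ 3 / β) ^ k :=
    gaussAvg_pow_even_le_of_polyCert_of_le H hβpos hFc hFg k hk
  have hE2 : gaussAvg β H (fun a => (β * KW) ^ (2 * k) * GW a ^ (2 * k)) ≤
      (β * KW) ^ (2 * k) * ((2 * k - 1 : ℝ) ^ (k * 4) * (9720 ^ 2 * C₈ * (H : ℝ) ^ 8 / β ^ 4) ^ k) := by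
    rw [EdgeChartGaussian.gaussAvg_const_mul]
    exact mul_le_mul_of_nonneg_left (gaussAvg_pow_even_le_of_polyCert_of_le H hβpos hcGW hBW k hk) (heven.pow_nonneg _)
  have hE3 : gaussAvg β H (fun a => (β * KΦ) ^ (2 * k) * GΦ a ^ (2 * k)) ≤
      (β * KΦ) ^ (2 * k) * ((2 * k - 1 : ℝ) ^ (k * 4) * (2 ^ 20 * C₈ * (H : ℝ) ^ 8 / β ^ 4) ^ k) := by
    rw [EdgeChartGaussian.gaussAvg_const_mul]
    exact mul_le_mul_of_nonneg_left (gaussAvg_pow_even_le_of_polyCert_of_le H hβpos hcGΦ hBΦ k hk) (heven.pow_nonneg _)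
  have hE4 : gaussAvg β H (fun a => (quadVal M a - cM) ^ (2 * k)) ≤ (2 * k - 1 : ℝ) ^ (k * 2) * (Cb * Cg * ((H : ℝ) ^ 8 * (1 + Real.log H) ^ mg / β ^ 2)) ^ k := by
    have hB : gaussAvg β H (fun a => (quadVal M a - cM) ^ 2) ≤ Cb * Cg * ((H : ℝ) ^ 8 * (1 + Real.log H) ^ mg / β ^ 2) := by
      calc gaussAvg β H (fun a => (quadVal M a - cM) ^ 2) ≤ Cb * ((H : ℝ) ^ 4 / β ^ 2) * ∑ i, ∑ j, M i j ^ 2 := by rw [hcM]; exact hCb H hH β hβpos M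
        _ ≤ Cb * ((H : ℝ) ^ 4 / β ^ 2) * (Cg * (H : ℝ) ^ 4 * (1 + Real.log H) ^ mg) := mul_le_mul_of_nonneg_left hM (by positivity)
        _ = Cb * Cg * ((H : ℝ) ^ 8 * (1 + Real.log H) ^ mg / β ^ 2) := by ring
    exact gaussAvg_pow_even_le_of_polyCert_of_le H hβpos (polyCert_quadVal_sub M cM) hB k hk
  have hE5 : gaussAvg β H (fun a => (quadVal Mh a - ch) ^ (2 * k)) ≤ (2 * k - 1 : ℝ) ^ (k * 2) * (Cb * 72 * ((H : ℝ) ^ 8 / β ^ 2)) ^ k := by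
    have hB : gaussAvg β H (fun a => (quadVal Mh a - ch) ^ 2) ≤ Cb * 72 * ((H : ℝ) ^ 8 / β ^ 2) := by
      have hc3 : (Fintype.card (LandauFree H × Fin 3) : ℝ) * (-(1 / 3 : ℝ)) ^ 2 = n / 3 := by
        rw [Fintype.card_prod, Fintype.card_fin, Nat.cast_mul, ← hn]; push_cast; ring
      have h := hCb H hH β hβpos Mh
      rw [sum_sq_smul_one, hc3, ← hch] at h
      have hq : 0 ≤ Cb * ((H : ℝ) ^ 4 / β ^ 2) := by positivity
      have hn3 : n / 3 ≤ 72 * (H : ℝ) ^ 4 := by linarith only [hnle]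
      calc gaussAvg β H (fun a => (quadVal Mh a - ch) ^ 2) ≤ Cb * ((H : ℝ) ^ 4 / β ^ 2) * (n / 3) := h
        _ ≤ Cb * ((H : ℝ) ^ 4 / β ^ 2) * (72 * (H : ℝ) ^ 4) := mul_le_mul_of_nonneg_left hn3 hq
        _ = Cb * 72 * ((H : ℝ) ^ 8 / β ^ 2) := by ring
    exact gaussAvg_pow_even_le_of_polyCert_of_le H hβpos (polyCert_quadVal_sub Mh ch) hB k hk
  -- (5) pure-real bookkeeping: every one of the eight terms is `≤ (its constant)·L^{m k}·R`
  obtain ⟨R, hR⟩ : ∃ R : ℝ, R = A ^ k + (β * (H : ℝ) ^ 4 * s ^ 5) ^ (2 * k) + ((H : ℝ) ^ 6 * s ^ 3) ^ (2 * k) + ((H : ℝ) ^ 4 * s ^ 4) ^ (2 * k) :=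
    ⟨_, rfl⟩
  have hq1 : 0 ≤ A ^ k := by positivity
  have hq2 : 0 ≤ (β * (H : ℝ) ^ 4 * s ^ 5) ^ (2 * k) := by positivity
  have hq3 : 0 ≤ ((H : ℝ) ^ 6 * s ^ 3) ^ (2 * k) := by positivity
  have hq4 : 0 ≤ ((H : ℝ) ^ 4 * s ^ 4) ^ (2 * k) := by positivity
  have hR1 : A ^ k ≤ R := by rw [hR]; linarith only [hq2, hq3, hq4]
  have hR2 : (β * (H : ℝ) ^ 4 * s ^ 5) ^ (2 * k) ≤ R := by rw [hR]; linarith only [hq1, hq3, hq4]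
  have hR3 : ((H : ℝ) ^ 6 * s ^ 3) ^ (2 * k) ≤ R := by rw [hR]; linarith only [hq1, hq2, hq4]
  have hR4 : ((H : ℝ) ^ 4 * s ^ 4) ^ (2 * k) ≤ R := by rw [hR]; linarith only [hq1, hq2, hq3]
  have hR0 : 0 ≤ R := hq1.trans hR1
  have hA2 : (A ^ 2) ^ k ≤ R := (sq_pow_le_pow_of_le_one hA0 hA1 k).trans hR1
  -- powers of `L`
  obtain ⟨Lm, hLmdef⟩ : ∃ x : ℝ, x = L ^ (3 * k + 2 * (k * mg)) := ⟨_, rfl⟩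
  have hLm : ∀ j : ℕ, j ≤ 3 * k + 2 * (k * mg) → L ^ j ≤ Lm := fun j hj => by rw [hLmdef]; exact pow_le_pow_right₀ hL1 hj
  have hLm0 : 1 ≤ Lm := by rw [hLmdef]; exact one_le_pow₀ hL1
  have hL0 : 0 ≤ L := zero_le_one.trans hL1
  have hLmpos : 0 ≤ Lm := zero_le_one.trans hLm0
  have hLmR : R ≤ Lm * R := le_mul_of_one_le_left hR0 hLm0
  -- T1
  have t1 : y₁ ^ (2 * k) ≤ CV ^ (2 * k) * (Lm * R) := by
    have e : y₁ ^ (2 * k) = CV ^ (2 * k) * (β * (H : ℝ) ^ 4 * s ^ 5) ^ (2 * k) := by rw [hy₁]; ring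
    rw [e]
    exact mul_le_mul_of_nonneg_left (hR2.trans hLmR) (by positivity)
  -- T2
  have t2 : (2 * k - 1 : ℝ) ^ (k * 3) * (CV * (H : ℝ) ^ 4 * (1 + Real.log H) ^ 3 / β) ^ k ≤ (2 * k - 1 : ℝ) ^ (k * 3) * CV ^ k * (Lm * R) := by
    have e : (CV * (H : ℝ) ^ 4 * (1 + Real.log H) ^ 3 / β) ^ k = CV ^ k * (L ^ (3 * k) * A ^ k) := by
      rw [hA, ← hL]; ring
    rw [e, ← mul_assoc]
    refine mul_le_mul_of_nonneg_left ?_ (by positivity)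
    exact mul_le_mul (hLm _ (by omega)) hR1 (by positivity) hLmpos
  -- T3
  have t3 : (β * KW) ^ (2 * k) * ((2 * k - 1 : ℝ) ^ (k * 4) * (9720 ^ 2 * C₈ * (H : ℝ) ^ 8 / β ^ 4) ^ k) ≤
      (2 * k - 1 : ℝ) ^ (k * 4) * (KW ^ 2 * (9720 ^ 2 * C₈)) ^ k * (Lm * R) := by
    have e1 : (β * KW) ^ (2 * k) * (9720 ^ 2 * C₈ * (H : ℝ) ^ 8 / β ^ 4) ^ k = ((β * KW) ^ 2 * (9720 ^ 2 * C₈ * (H : ℝ) ^ 8 / β ^ 4)) ^ k := by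
      rw [pow_mul, ← mul_pow]
    have e2 : (β * KW) ^ 2 * (9720 ^ 2 * C₈ * (H : ℝ) ^ 8 / β ^ 4) = KW ^ 2 * (9720 ^ 2 * C₈) * A ^ 2 := by
      rw [hA]; field_simp
    calc (β * KW) ^ (2 * k) * ((2 * k - 1 : ℝ) ^ (k * 4) * (9720 ^ 2 * C₈ * (H : ℝ) ^ 8 / β ^ 4) ^ k)
        = (2 * k - 1 : ℝ) ^ (k * 4) * ((β * KW) ^ (2 * k) * (9720 ^ 2 * C₈ * (H : ℝ) ^ 8 / β ^ 4) ^ k) := by ring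
      _ = (2 * k - 1 : ℝ) ^ (k * 4) * (KW ^ 2 * (9720 ^ 2 * C₈)) ^ k * (A ^ 2) ^ k := by rw [e1, e2, mul_pow]; ring
      _ ≤ (2 * k - 1 : ℝ) ^ (k * 4) * (KW ^ 2 * (9720 ^ 2 * C₈)) ^ k * (Lm * R) :=
          mul_le_mul_of_nonneg_left (hA2.trans hLmR) (by positivity)
  -- T4
  have t4 : (β * KΦ) ^ (2 * k) * ((2 * k - 1 : ℝ) ^ (k * 4) * (2 ^ 20 * C₈ * (H : ℝ) ^ 8 / β ^ 4) ^ k) ≤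
      (2 * k - 1 : ℝ) ^ (k * 4) * (KΦ ^ 2 * (2 ^ 20 * C₈)) ^ k * (Lm * R) := by
    have e1 : (β * KΦ) ^ (2 * k) * (2 ^ 20 * C₈ * (H : ℝ) ^ 8 / β ^ 4) ^ k = ((β * KΦ) ^ 2 * (2 ^ 20 * C₈ * (H : ℝ) ^ 8 / β ^ 4)) ^ k := by
      rw [pow_mul, ← mul_pow]
    have e2 : (β * KΦ) ^ 2 * (2 ^ 20 * C₈ * (H : ℝ) ^ 8 / β ^ 4) = KΦ ^ 2 * (2 ^ 20 * C₈) * A ^ 2 := by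
      rw [hA]; field_simp
    calc (β * KΦ) ^ (2 * k) * ((2 * k - 1 : ℝ) ^ (k * 4) * (2 ^ 20 * C₈ * (H : ℝ) ^ 8 / β ^ 4) ^ k)
        = (2 * k - 1 : ℝ) ^ (k * 4) * ((β * KΦ) ^ (2 * k) * (2 ^ 20 * C₈ * (H : ℝ) ^ 8 / β ^ 4) ^ k) := by ring
      _ = (2 * k - 1 : ℝ) ^ (k * 4) * (KΦ ^ 2 * (2 ^ 20 * C₈)) ^ k * (A ^ 2) ^ k := by rw [e1, e2, mul_pow]; ring
      _ ≤ (2 * k - 1 : ℝ) ^ (k * 4) * (KΦ ^ 2 * (2 ^ 20 * C₈)) ^ k * (Lm * R) :=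
          mul_le_mul_of_nonneg_left (hA2.trans hLmR) (by positivity)
  -- T5
  have t5 : y₅ ^ (2 * k) ≤ Cg ^ (2 * k) * (Lm * R) := by
    have e : y₅ ^ (2 * k) = Cg ^ (2 * k) * (L ^ (2 * (k * mg)) * ((H : ℝ) ^ 6 * s ^ 3) ^ (2 * k)) := by rw [hy₅, ← hL]; ring
    rw [e]
    refine mul_le_mul_of_nonneg_left ?_ (by positivity)
    exact mul_le_mul (hLm _ (by omega)) hR3 (by positivity) hLmpos
  -- T6
  have t6 : (2 * k - 1 : ℝ) ^ (k * 2) * (Cb * Cg * ((H : ℝ) ^ 8 * (1 + Real.log H) ^ mg / β ^ 2)) ^ k ≤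
      (2 * k - 1 : ℝ) ^ (k * 2) * (Cb * Cg) ^ k * (Lm * R) := by
    have e : (Cb * Cg * ((H : ℝ) ^ 8 * (1 + Real.log H) ^ mg / β ^ 2)) ^ k = (Cb * Cg) ^ k * (L ^ (k * mg) * (A ^ 2) ^ k) := by
      rw [hA, ← hL]; ring
    rw [e, ← mul_assoc]
    refine mul_le_mul_of_nonneg_left ?_ (by positivity)
    exact mul_le_mul (hLm _ (by omega)) ((sq_pow_le_pow_of_le_one hA0 hA1 k).trans hR1) (by positivity) hLmpos
  -- T7
  have t7 : y₇ ^ (2 * k) ≤ (Ch * 216) ^ (2 * k) * (Lm * R) := by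
    have h1 : y₇ ≤ Ch * 216 * ((H : ℝ) ^ 4 * s ^ 4) := by
      rw [hy₇]
      calc Ch * n * s ^ 4 ≤ Ch * (216 * (H : ℝ) ^ 4) * s ^ 4 :=
            mul_le_mul_of_nonneg_right (mul_le_mul_of_nonneg_left hnle hCh0) (by positivity)
        _ = Ch * 216 * ((H : ℝ) ^ 4 * s ^ 4) := by ring
    calc y₇ ^ (2 * k) ≤ (Ch * 216 * ((H : ℝ) ^ 4 * s ^ 4)) ^ (2 * k) := pow_le_pow_left₀ hy₇0 h1 _
      _ = (Ch * 216) ^ (2 * k) * ((H : ℝ) ^ 4 * s ^ 4) ^ (2 * k) := by rw [mul_pow]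
      _ ≤ (Ch * 216) ^ (2 * k) * (Lm * R) := mul_le_mul_of_nonneg_left (hR4.trans hLmR) (by positivity)
  -- T8
  have t8 : (2 * k - 1 : ℝ) ^ (k * 2) * (Cb * 72 * ((H : ℝ) ^ 8 / β ^ 2)) ^ k ≤ (2 * k - 1 : ℝ) ^ (k * 2) * (Cb * 72) ^ k * (Lm * R) := by
    have e : (Cb * 72 * ((H : ℝ) ^ 8 / β ^ 2)) ^ k = (Cb * 72) ^ k * (A ^ 2) ^ k := by rw [hA]; ring
    rw [e, ← mul_assoc]
    exact mul_le_mul_of_nonneg_left (hA2.trans hLmR) (by positivity)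
  -- (6) assemble
  have hsf0 : ∀ a, 0 ≤ sfInd H s a * (tiltU β H a - (cM + ch)) ^ (2 * k) := fun a =>
    mul_nonneg (by unfold sfInd; exact Set.indicator_nonneg (fun _ _ => zero_le_one) _) (heven.pow_nonneg _)
  have h8 : (0 : ℝ) ≤ 8 ^ (2 * k - 1) := by positivity
  have hfinal : gaussAvg β H P + Kc ≤ (CV ^ (2 * k) + (2 * k - 1 : ℝ) ^ (k * 3) * CV ^ k + (2 * k - 1 : ℝ) ^ (k * 4) * (KW ^ 2 * (9720 ^ 2 * C₈)) ^ k +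
      (2 * k - 1 : ℝ) ^ (k * 4) * (KΦ ^ 2 * (2 ^ 20 * C₈)) ^ k + Cg ^ (2 * k) + (2 * k - 1 : ℝ) ^ (k * 2) * (Cb * Cg) ^ k +
      (Ch * 216) ^ (2 * k) + (2 * k - 1 : ℝ) ^ (k * 2) * (Cb * 72) ^ k) * (Lm * R) := by
    rw [hEP, hKc]
    have s1 := hE1.trans t2
    have s2 := hE2.trans t3
    have s3 := hE3.trans t4
    have s4 := hE4.trans t6
    have s5 := hE5.trans t8
    linarith only [t1, t5, t7, s1, s2, s3, s4, s5]
  calc gaussAvg β H (fun a => sfInd H s a * (tiltU β H a - (cM + ch)) ^ (2 * k))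
      ≤ gaussAvg β H (fun a => 8 ^ (2 * k - 1) * (P a + Kc)) := gaussAvg_mono_of_nonneg H hβpos hsf0 hdom hiMaj
    _ = 8 ^ (2 * k - 1) * (gaussAvg β H P + Kc) := hEMaj
    _ ≤ 8 ^ (2 * k - 1) * ((CV ^ (2 * k) + (2 * k - 1 : ℝ) ^ (k * 3) * CV ^ k + (2 * k - 1 : ℝ) ^ (k * 4) * (KW ^ 2 * (9720 ^ 2 * C₈)) ^ k +
          (2 * k - 1 : ℝ) ^ (k * 4) * (KΦ ^ 2 * (2 ^ 20 * C₈)) ^ k + Cg ^ (2 * k) + (2 * k - 1 : ℝ) ^ (k * 2) * (Cb * Cg) ^ k +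
          (Ch * 216) ^ (2 * k) + (2 * k - 1 : ℝ) ^ (k * 2) * (Cb * 72) ^ k) * (Lm * R)) := mul_le_mul_of_nonneg_left hfinal h8
    _ = Cst k * (1 + Real.log H) ^ (3 * k + 2 * (k * mg)) *
          (((H : ℝ) ^ 4 / β) ^ k + (β * (H : ℝ) ^ 4 * s ^ 5) ^ (2 * k) + ((H : ℝ) ^ 6 * s ^ 3) ^ (2 * k) + ((H : ℝ) ^ 4 * s ^ 4) ^ (2 * k)) := by
        rw [hCst, hLmdef, hR, hA, hL]; ring

end GaussNormalForm

end Summit.QuantumFields.YangMills.Theorems.AllWindowsColdBoxBoxHighLine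

end
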